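import Literature.Topology.FourManifolds.HCobordismSlideStepGerm
import HarnessLib

/-!
# Milnor 1965, Thm. 7.6 (Basis Theorem) on a slab: the crossing hypothesis split into the
# transverse value `D_R(p₂) · D_L'(p₁) = ±1` and the sign comparison of the two dockings

Topic `Literature/Topology/FourManifolds`; sequel to `HCobordismSlideStepAssembly.lean` and
`HCobordismSlideStepGerm.lean` for the named fact
`Literature.Topology.FourManifolds.Cobordism.Milnor1965_basisTheorem_slab` (Milnor, *Lectures on
the h-cobordism theorem* (1965), Thm. 7.6 on a slab).  The assembly
`Cobordism.Milnor1965_basisTheorem_slab_of_slideCrossing` leaves one hypothesis `HC` (for one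
docking `ρ` and every outcome of the geometric half: data `Tᵢ`, `Tⱼ` with the values
`Λᵢ(x') = tᵢ w₀`, `tᵢ = ±1`, `Λⱼ(x') = tⱼ w₀`, `uᵢ tᵢ = uⱼ tⱼ`).  Milnor's text (PDF p. 52 of the
held copy `lit read book:milnornd-lectures-h-cobordism-theorem`) has two separate statements
here — *"`D_L'(p₁)` intersects `D_R(p₂)` in a single point, transversely"* and *"with
intersection number `D_R(p₂) · D_L'(p₁) = +1`"* (the sign being the choice of the frame `μ(b)`
in Lemma 7.7, PDF p. 51; in the tree, the choice between the dockings `ρ` and `r ≫ ρ`) — and this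
file splits `HC` accordingly into two independent hypotheses:

* `HV` (**transversality at the crossing**): for EVERY docking `ρ` and every outcome, a
  transverse disc datum `Tⱼ` of `D_R(σ j)` (structural properties of
  `Cobordism.signDual_of_transverseDiscData`) whose functional takes the value `± w₀` on the class
  of every generator of `H_k(D_L'(σ i), S_L'(σ i))` — to be proved from the flow-regular datum
  (`Cobordism.exists_flowRegular_transverseDiscDatum`, `HCobordismSlideStepFlowRegularDatum.lean`),
  the crossing chart (`SlideSetting.exists_crossingChart`) and
  `Cobordism.functional_newDisc_crossing_eq_or_eq_neg'`, by computing the derivative of the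
  normal coordinate along the chart;
* `HSgn` (**the sign of one docking is `+1`**): for one docking `ρ` (depending on the basis
  `e`), every outcome, ANY data `Tᵢ`, `Tⱼ` with the structural properties, and any values
  `Λᵢ(eᵢ) = uᵢ w₀`, `Λⱼ(eⱼ) = uⱼ w₀`, `Λᵢ(x') = tᵢ w₀`, `Λⱼ(x') = tⱼ w₀` (all `±1`):
  `uᵢ tᵢ = uⱼ tⱼ`.  (The product `(uᵢ tᵢ)(uⱼ tⱼ)` does not depend on the data: two functionals
  sign-dual to `e` at the same index agree up to sign.)  To be proved by comparing the two
  dockings through `Literature.AlgebraicTopology.SingularHomology.exists_units_relLocalFamily_eq_smul`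
  along the crossing chart above the isotopy, where the slid discs of all constructions agree,
  and `SlideSetting.psiL_sheet_trans`.

* **`Cobordism.Milnor1965_basisTheorem_slab_of_crossingValue_of_crossingSign`** — `HV`, `HSgn`
  imply `Cobordism.Milnor1965_basisTheorem_slab`: `HC` follows, the datum `Tᵢ` and its value
  being `SlideSetting.exists_germDatum`.

Everything here is proved; no definitions, no named facts.

## References

* J. Milnor, *Lectures on the h-cobordism theorem*, notes by L. Siebenmann and J. Sondow,
  Princeton Mathematical Notes (1965): Thm. 7.6, Lemma 7.7 and the proof of Thm. 7.6 (PDF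
  pp. 50–52).  Held: `lit read book:milnornd-lectures-h-cobordism-theorem`. [MilnorHCobordism1965]
-/

open scoped Manifold ContDiff Topology
open Set Function Filter Metric CategoryTheory
open Literature.AlgebraicTopology.SingularHomology Literature.LinearAlgebra.FreeModule

noncomputable section

namespace Literature.Topology.FourManifolds

universe u

/-- **Thm. 7.6 on a slab from the transverse value at the crossing and the sign of one
docking** (Milnor 1965, proof of Thm. 7.6, PDF pp. 50–52): `HV` (*"in a single point,
transversely"*) and `HSgn` (*"with intersection number `+1`"*) imply
`Cobordism.Milnor1965_basisTheorem_slab`, through `Cobordism.Milnor1965_basisTheorem_slab_of_slideCrossing`: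
its hypothesis `HC` is assembled from `ρ` of `HSgn`, the datum `Tᵢ` with its germ value of
`SlideSetting.exists_germDatum`, the datum `Tⱼ` with its value of `HV`, and the sign of `HSgn`.
[cite: MilnorHCobordism1965, Thm. 7.6 and its proof with Lemma 7.7 (PDF pp. 50–52)] -/
theorem Cobordism.Milnor1965_basisTheorem_slab_of_crossingValue_of_crossingSign
    (HV : ∀ {n : ℕ} {M N : Type u} [TopologicalSpace M] [T2Space M] [SecondCountableTopology M]
      [ChartedSpace (EuclideanSpace ℝ (Fin n)) M] [IsManifold (𝓡 n) ∞ M] [CompactSpace M]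
      [TopologicalSpace N] [T2Space N] [SecondCountableTopology N]
      [ChartedSpace (EuclideanSpace ℝ (Fin n)) N] [IsManifold (𝓡 n) ∞ N] [CompactSpace N]
      {c : Cobordism n M N} {g : c.W → ℝ}
      {ξ : Cₛ^∞⟮𝓡∂ (n + 1); EuclideanSpace ℝ (Fin (n + 1)), (TangentSpace (𝓡∂ (n + 1)) : c.W → Type)⟯}
      {t₀ t₁ b : ℝ} {k a : ℕ} {σ : Fin a → c.W} {i j : Fin a}
      (S : SlideSetting c g ξ t₀ t₁ b k σ i j) (_ : t₁ < 1)
      {X : Set c.W} (_ : ∀ z, z ∈ X ↔ g z ∈ Icc t₀ t₁)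
      (ρ : (EuclideanSpace ℝ (Fin (k - 1))) ≃ₗᵢ[ℝ] EuclideanSpace ℝ (Fin (k - 1))),
      ∀ (f : S.V ≃ₘ⟮𝓡 n, 𝓡 n⟯ S.V) (_ : Diffeomorph.IsCompactlyDiffeotopicToIdIn S.W f)
        (_ : ∀ v ∈ S.Flat, ‖v‖ ≤ 1 → f (S.discA ρ v) = S.discB v)
        (Φ : OpenPartialHomeomorph S.V (SlideSetting.Model n k))
        (_ : ContMDiffOn (𝓡 n) 𝓘(ℝ, SlideSetting.Model n k) ∞ Φ Φ.source)
        (_ : ContMDiffOn 𝓘(ℝ, SlideSetting.Model n k) (𝓡 n) ∞ Φ.symm Φ.target)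
        (_ : ∀ z, Φ.symm z ∈ S.rightSphere S.jR ↔ z.1 = 2 ∧ z.2.1 = 0)
        (_ : ∀ l, l ≠ S.jR → ∀ z, Φ.symm z ∉ S.rightSphere l)
        (O : Set (SlideSetting.Model n k)) (_ : IsOpen O) (_ : {z | z.1 = 2 ∧ z.2.1 = 0} ⊆ O)
        (_ : ∀ z ∈ O, Φ.symm z = S.psiR z)
        (_ : ∀ v : EuclideanSpace ℝ (Fin n), ‖v‖ ≤ 1 / 8 →
          S.preB v ∈ Φ.target ∧ Φ.symm (S.preB v) = S.discB v)
        (r₀ : ℝ) (_ : 0 < r₀) (_ : {z : SlideSetting.Model n k | ‖z.2.2‖ < r₀} ⊆ Φ.target)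
        (δ : ℝ) (α : ℝ → ℝ) (_ : 0 < δ) (_ : ContDiff ℝ ∞ α) (_ : ∀ u, u ≤ δ → α u = 5 / 2)
        (_ : ∀ u, 2 * δ ≤ u → α u = 1) (_ : ∀ u, 1 ≤ α u ∧ α u ≤ 5 / 2)
        (F : AmbientIsotopy (𝓡 n) S.V)
        (_ : ∀ t, ∀ p ∈ S.leftSphere, ∀ l, F.toFun t p ∈ S.rightSphere l →
          l = S.jR ∧ p = S.discA ρ 0 ∧ 1 / 2 ≤ t ∧ Real.smoothTransition (2 * t - 1) = 2 / 3)
        (_ : ∀ t, 1 / 2 ≤ t → ∀ v ∈ S.Flat, ‖v‖ ≤ 1 / 8 →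
          F.toFun t (S.discA ρ v) = Φ.symm
            ((1 + Real.smoothTransition (2 * t - 1) * (α (‖(S.preB v).2.1‖ ^ 2) - 1),
              (S.preB v).2.1, (0 : EuclideanSpace ℝ (Fin (n - k)))) : SlideSetting.Model n k))
        (_ : ∀ t, t ≤ 1 / 2 → ∀ p ∈ S.W, F.toFun t p ∈ S.W)
        (_ : F.toFun 1 '' S.leftSphere ⊆ S.W)
        (ξ₃ : Cₛ^∞⟮𝓡∂ (n + 1); EuclideanSpace ℝ (Fin (n + 1)), (TangentSpace (𝓡∂ (n + 1)) : c.W → Type)⟯)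
        (_ : IsGradientLike (𝓡∂ (n + 1)) S.g₁ ξ₃)
        (_ : ∀ z, S.g₁ z ∉ Ioo S.c₀ S.c₁ → ξ₃ z = ξ z)
        (_ : ∀ x, S.g₁ x = S.c₁ → ∀ v : S.V, FlowsTo (𝓡∂ (n + 1)) ξ (S.ι v) x →
          FlowsTo (𝓡∂ (n + 1)) ξ₃ (S.ι (F.toFun 1 v)) x)
        (_ : ∀ x, S.g₁ x = S.c₁ → ∀ v : S.V, FlowsTo (𝓡∂ (n + 1)) ξ₃ (S.ι v) x →
          ∃ v₀ : S.V, F.toFun 1 v₀ = v ∧ FlowsTo (𝓡∂ (n + 1)) ξ (S.ι v₀) x)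
        (ν : ℝ → ℝ) (_ : Continuous ν) (_ : ν S.c₀ = 1) (_ : ν S.c₁ = 0) (_ : ∀ t, 0 ≤ ν t ∧ ν t ≤ 1)
        (t₁' t₂' : ℝ) (_ : S.c₀ < t₁') (_ : t₁' < t₂') (_ : t₂' < S.c₁)
        (_ : ∀ t, ν t = Real.smoothTransition ((t₂' - t) / (t₂' - t₁')))
        (_ : ∀ q : S.V, ∀ τ ∈ Icc 0 (S.c₁ - S.c₀), ∃ y : c.W, S.g₁ y = S.c₀ + τ ∧
          FlowsTo (𝓡∂ (n + 1)) ξ (S.ι (F.toFun (ν (S.c₀ + τ)) q)) y ∧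
          FlowsTo (𝓡∂ (n + 1)) ξ₃ (S.ι (F.toFun 1 q)) y)
        (_ : leftHandSphere (𝓡∂ (n + 1)) S.g₁ ξ₃ (σ i) S.c₀ = S.ι '' (F.toFun 1 '' S.leftSphere))
        (_ : ∀ l : {l : Fin a // l ≠ i},
          rightHandSphere (𝓡∂ (n + 1)) S.g₁ ξ₃ (σ l) S.c₀ = S.ι '' S.rightSphere l)
        (_ : ∀ l : {l : Fin a // l ≠ i},
          Disjoint (trajectorySet (𝓡∂ (n + 1)) ξ₃ (σ l)) (trajectorySet (𝓡∂ (n + 1)) ξ₃ (σ i)))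
        (g' : c.W → ℝ) (_ : c.IsMorseFunction g') (_ : IsGradientLike (𝓡∂ (n + 1)) g' ξ₃)
        (_ : criticalSet (𝓡∂ (n + 1)) g' = criticalSet (𝓡∂ (n + 1)) g)
        (_ : ∀ z ∈ criticalSet (𝓡∂ (n + 1)) g, morseIndex (𝓡∂ (n + 1)) g' z = morseIndex (𝓡∂ (n + 1)) g z)
        (_ : ∀ l, g' (σ l) = b)
        (_ : ∀ᶠ z in 𝓝ˢ {z | S.g₁ z ∉ Ioo S.u S.v}, g' z = S.g₁ z)
        (_ : ∀ z, S.g₁ z ∈ Ioo S.u S.v → g' z ∈ Ioo S.u S.v)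
        (_ : ∀ z, g z ∉ Ioo S.u S.v → g' z = g z)
        (_ : ∀ z, g z ∈ Ioo S.u S.v → g' z ∈ Ioo S.u S.v)
        (_ : ∀ᶠ z in 𝓝 (σ i), g' z = S.g₁ z + (b - S.bP))
        (_ : ∀ l, l ≠ i → ∀ᶠ z in 𝓝 (σ l), g' z = S.g₁ z)
        (g𝔼 : HomologicalOrientation ℤ (EuclideanSpace ℝ (Fin k)) k),
      ∃ (Tj : TransverseDiscDatum ↥X k) (hDNj : Tj.disc ⊆ Tj.N),
        (∀ z : ↥X, z ∈ Tj.P ↔ (z : c.W) ∈ unstableSet (𝓡∂ (n + 1)) (⇑ξ) (σ j)) ∧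
        (((Tj.m 0 : ↥X) : c.W) = σ j) ∧
        (∀ z ∈ Tj.disc, (z : c.W) ∈ stableSet (𝓡∂ (n + 1)) (⇑ξ) (σ j)) ∧
        (Tj.disc ∈ 𝓝[{z : ↥X | (z : c.W) ∈ stableSet (𝓡∂ (n + 1)) (⇑ξ) (σ j)}] (Tj.m 0)) ∧
        (∀ (v : EuclideanSpace ℝ (Fin k)) (hv : v ∈ closedBall (0 : EuclideanSpace ℝ (Fin k)) Tj.r),
          Tj.K ⟨Tj.m v, hDNj (mem_image_of_mem _ hv)⟩ = v) ∧
        ∀ {A : Set ↥X} (hAj : A ⊆ Tj.Pᶜ)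
          (h₁' : leftHandDisc (𝓡∂ (n + 1)) g' ξ₃ (σ i) t₀ ⊆ X)
          (h₀' : MapsTo (Set.inclusion h₁')
            (Subtype.val ⁻¹' leftHandSphere (𝓡∂ (n + 1)) g' ξ₃ (σ i) t₀) A)
          (γ₀ : relativeSingularHomology ℤ ℤ ↥(leftHandDisc (𝓡∂ (n + 1)) g' ξ₃ (σ i) t₀)
            (Subtype.val ⁻¹' leftHandSphere (𝓡∂ (n + 1)) g' ξ₃ (σ i) t₀) k)
          (_ : ∃ φ : _ ≃ₗ[ℤ] ℤ, φ γ₀ = 1),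
          Tj.functional hAj k ((relativeSingularHomology.map ℤ ℤ
              (⟨Set.inclusion h₁', continuous_inclusion h₁'⟩ :
                C(↥(leftHandDisc (𝓡∂ (n + 1)) g' ξ₃ (σ i) t₀), ↥X)) h₀' k).hom γ₀) = Tj.baseClass g𝔼 ∨
            Tj.functional hAj k ((relativeSingularHomology.map ℤ ℤ
              (⟨Set.inclusion h₁', continuous_inclusion h₁'⟩ :
                C(↥(leftHandDisc (𝓡∂ (n + 1)) g' ξ₃ (σ i) t₀), ↥X)) h₀' k).hom γ₀) = -Tj.baseClass g𝔼)
    (HSgn : ∀ {n : ℕ} {M N : Type u} [TopologicalSpace M] [T2Space M] [SecondCountableTopology M]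
      [ChartedSpace (EuclideanSpace ℝ (Fin n)) M] [IsManifold (𝓡 n) ∞ M] [CompactSpace M]
      [TopologicalSpace N] [T2Space N] [SecondCountableTopology N]
      [ChartedSpace (EuclideanSpace ℝ (Fin n)) N] [IsManifold (𝓡 n) ∞ N] [CompactSpace N]
      {c : Cobordism n M N} {g : c.W → ℝ}
      {ξ : Cₛ^∞⟮𝓡∂ (n + 1); EuclideanSpace ℝ (Fin (n + 1)), (TangentSpace (𝓡∂ (n + 1)) : c.W → Type)⟯}
      {t₀ t₁ b : ℝ} {k a : ℕ} {σ : Fin a → c.W} {i j : Fin a}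
      (S : SlideSetting c g ξ t₀ t₁ b k σ i j) (_ : t₁ < 1)
      {X : Set c.W} (_ : ∀ z, z ∈ X ↔ g z ∈ Icc t₀ t₁)
      {A : Set ↥X} (_ : ∀ z : ↥X, z ∈ A ↔ g z = t₀)
      (e : Module.Basis (Fin a) ℤ (relativeSingularHomology ℤ ℤ ↥X A k))
      (_ : ∀ l, ∃ (h₁ : leftHandDisc (𝓡∂ (n + 1)) g ξ (σ l) t₀ ⊆ X)
        (h₀ : MapsTo (Set.inclusion h₁)
          (Subtype.val ⁻¹' leftHandSphere (𝓡∂ (n + 1)) g ξ (σ l) t₀) A),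
        ∃ γ, (relativeSingularHomology.map ℤ ℤ
          (⟨Set.inclusion h₁, continuous_inclusion h₁⟩ :
            C(↥(leftHandDisc (𝓡∂ (n + 1)) g ξ (σ l) t₀), ↥X)) h₀ k).hom γ = e l)
      (g𝔼 : HomologicalOrientation ℤ (EuclideanSpace ℝ (Fin k)) k),
      ∃ ρ : (EuclideanSpace ℝ (Fin (k - 1))) ≃ₗᵢ[ℝ] EuclideanSpace ℝ (Fin (k - 1)),
      ∀ (f : S.V ≃ₘ⟮𝓡 n, 𝓡 n⟯ S.V) (_ : Diffeomorph.IsCompactlyDiffeotopicToIdIn S.W f)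
        (_ : ∀ v ∈ S.Flat, ‖v‖ ≤ 1 → f (S.discA ρ v) = S.discB v)
        (Φ : OpenPartialHomeomorph S.V (SlideSetting.Model n k))
        (_ : ContMDiffOn (𝓡 n) 𝓘(ℝ, SlideSetting.Model n k) ∞ Φ Φ.source)
        (_ : ContMDiffOn 𝓘(ℝ, SlideSetting.Model n k) (𝓡 n) ∞ Φ.symm Φ.target)
        (_ : ∀ z, Φ.symm z ∈ S.rightSphere S.jR ↔ z.1 = 2 ∧ z.2.1 = 0)
        (_ : ∀ l, l ≠ S.jR → ∀ z, Φ.symm z ∉ S.rightSphere l)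
        (O : Set (SlideSetting.Model n k)) (_ : IsOpen O) (_ : {z | z.1 = 2 ∧ z.2.1 = 0} ⊆ O)
        (_ : ∀ z ∈ O, Φ.symm z = S.psiR z)
        (_ : ∀ v : EuclideanSpace ℝ (Fin n), ‖v‖ ≤ 1 / 8 →
          S.preB v ∈ Φ.target ∧ Φ.symm (S.preB v) = S.discB v)
        (r₀ : ℝ) (_ : 0 < r₀) (_ : {z : SlideSetting.Model n k | ‖z.2.2‖ < r₀} ⊆ Φ.target)
        (δ : ℝ) (α : ℝ → ℝ) (_ : 0 < δ) (_ : ContDiff ℝ ∞ α) (_ : ∀ u, u ≤ δ → α u = 5 / 2)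
        (_ : ∀ u, 2 * δ ≤ u → α u = 1) (_ : ∀ u, 1 ≤ α u ∧ α u ≤ 5 / 2)
        (F : AmbientIsotopy (𝓡 n) S.V)
        (_ : ∀ t, ∀ p ∈ S.leftSphere, ∀ l, F.toFun t p ∈ S.rightSphere l →
          l = S.jR ∧ p = S.discA ρ 0 ∧ 1 / 2 ≤ t ∧ Real.smoothTransition (2 * t - 1) = 2 / 3)
        (_ : ∀ t, 1 / 2 ≤ t → ∀ v ∈ S.Flat, ‖v‖ ≤ 1 / 8 →
          F.toFun t (S.discA ρ v) = Φ.symm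
            ((1 + Real.smoothTransition (2 * t - 1) * (α (‖(S.preB v).2.1‖ ^ 2) - 1),
              (S.preB v).2.1, (0 : EuclideanSpace ℝ (Fin (n - k)))) : SlideSetting.Model n k))
        (_ : ∀ t, t ≤ 1 / 2 → ∀ p ∈ S.W, F.toFun t p ∈ S.W)
        (_ : F.toFun 1 '' S.leftSphere ⊆ S.W)
        (ξ₃ : Cₛ^∞⟮𝓡∂ (n + 1); EuclideanSpace ℝ (Fin (n + 1)), (TangentSpace (𝓡∂ (n + 1)) : c.W → Type)⟯)
        (_ : IsGradientLike (𝓡∂ (n + 1)) S.g₁ ξ₃)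
        (_ : ∀ z, S.g₁ z ∉ Ioo S.c₀ S.c₁ → ξ₃ z = ξ z)
        (_ : ∀ x, S.g₁ x = S.c₁ → ∀ v : S.V, FlowsTo (𝓡∂ (n + 1)) ξ (S.ι v) x →
          FlowsTo (𝓡∂ (n + 1)) ξ₃ (S.ι (F.toFun 1 v)) x)
        (_ : ∀ x, S.g₁ x = S.c₁ → ∀ v : S.V, FlowsTo (𝓡∂ (n + 1)) ξ₃ (S.ι v) x →
          ∃ v₀ : S.V, F.toFun 1 v₀ = v ∧ FlowsTo (𝓡∂ (n + 1)) ξ (S.ι v₀) x)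
        (ν : ℝ → ℝ) (_ : Continuous ν) (_ : ν S.c₀ = 1) (_ : ν S.c₁ = 0) (_ : ∀ t, 0 ≤ ν t ∧ ν t ≤ 1)
        (t₁' t₂' : ℝ) (_ : S.c₀ < t₁') (_ : t₁' < t₂') (_ : t₂' < S.c₁)
        (_ : ∀ t, ν t = Real.smoothTransition ((t₂' - t) / (t₂' - t₁')))
        (_ : ∀ q : S.V, ∀ τ ∈ Icc 0 (S.c₁ - S.c₀), ∃ y : c.W, S.g₁ y = S.c₀ + τ ∧
          FlowsTo (𝓡∂ (n + 1)) ξ (S.ι (F.toFun (ν (S.c₀ + τ)) q)) y ∧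
          FlowsTo (𝓡∂ (n + 1)) ξ₃ (S.ι (F.toFun 1 q)) y)
        (_ : leftHandSphere (𝓡∂ (n + 1)) S.g₁ ξ₃ (σ i) S.c₀ = S.ι '' (F.toFun 1 '' S.leftSphere))
        (_ : ∀ l : {l : Fin a // l ≠ i},
          rightHandSphere (𝓡∂ (n + 1)) S.g₁ ξ₃ (σ l) S.c₀ = S.ι '' S.rightSphere l)
        (_ : ∀ l : {l : Fin a // l ≠ i},
          Disjoint (trajectorySet (𝓡∂ (n + 1)) ξ₃ (σ l)) (trajectorySet (𝓡∂ (n + 1)) ξ₃ (σ i)))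
        (g' : c.W → ℝ) (_ : c.IsMorseFunction g') (_ : IsGradientLike (𝓡∂ (n + 1)) g' ξ₃)
        (_ : criticalSet (𝓡∂ (n + 1)) g' = criticalSet (𝓡∂ (n + 1)) g)
        (_ : ∀ z ∈ criticalSet (𝓡∂ (n + 1)) g, morseIndex (𝓡∂ (n + 1)) g' z = morseIndex (𝓡∂ (n + 1)) g z)
        (_ : ∀ l, g' (σ l) = b)
        (_ : ∀ᶠ z in 𝓝ˢ {z | S.g₁ z ∉ Ioo S.u S.v}, g' z = S.g₁ z)
        (_ : ∀ z, S.g₁ z ∈ Ioo S.u S.v → g' z ∈ Ioo S.u S.v)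
        (_ : ∀ z, g z ∉ Ioo S.u S.v → g' z = g z)
        (_ : ∀ z, g z ∈ Ioo S.u S.v → g' z ∈ Ioo S.u S.v)
        (_ : ∀ᶠ z in 𝓝 (σ i), g' z = S.g₁ z + (b - S.bP))
        (_ : ∀ l, l ≠ i → ∀ᶠ z in 𝓝 (σ l), g' z = S.g₁ z),
      ∀ (Ti Tj : TransverseDiscDatum ↥X k) (hDNi : Ti.disc ⊆ Ti.N) (hDNj : Tj.disc ⊆ Tj.N)
        (_ : ∀ z : ↥X, z ∈ Ti.P ↔ (z : c.W) ∈ unstableSet (𝓡∂ (n + 1)) (⇑ξ) (σ i))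
        (_ : (((Ti.m 0 : ↥X) : c.W) = σ i))
        (_ : ∀ z ∈ Ti.disc, (z : c.W) ∈ stableSet (𝓡∂ (n + 1)) (⇑ξ) (σ i))
        (_ : Ti.disc ∈ 𝓝[{z : ↥X | (z : c.W) ∈ stableSet (𝓡∂ (n + 1)) (⇑ξ) (σ i)}] (Ti.m 0))
        (_ : ∀ (v : EuclideanSpace ℝ (Fin k)) (hv : v ∈ closedBall (0 : EuclideanSpace ℝ (Fin k)) Ti.r),
          Ti.K ⟨Ti.m v, hDNi (mem_image_of_mem _ hv)⟩ = v)
        (_ : ∀ z : ↥X, z ∈ Tj.P ↔ (z : c.W) ∈ unstableSet (𝓡∂ (n + 1)) (⇑ξ) (σ j))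
        (_ : (((Tj.m 0 : ↥X) : c.W) = σ j))
        (_ : ∀ z ∈ Tj.disc, (z : c.W) ∈ stableSet (𝓡∂ (n + 1)) (⇑ξ) (σ j))
        (_ : Tj.disc ∈ 𝓝[{z : ↥X | (z : c.W) ∈ stableSet (𝓡∂ (n + 1)) (⇑ξ) (σ j)}] (Tj.m 0))
        (_ : ∀ (v : EuclideanSpace ℝ (Fin k)) (hv : v ∈ closedBall (0 : EuclideanSpace ℝ (Fin k)) Tj.r),
          Tj.K ⟨Tj.m v, hDNj (mem_image_of_mem _ hv)⟩ = v)
        (h₁' : leftHandDisc (𝓡∂ (n + 1)) g' ξ₃ (σ i) t₀ ⊆ X)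
        (h₀' : MapsTo (Set.inclusion h₁')
          (Subtype.val ⁻¹' leftHandSphere (𝓡∂ (n + 1)) g' ξ₃ (σ i) t₀) A)
        (γ₀ : relativeSingularHomology ℤ ℤ ↥(leftHandDisc (𝓡∂ (n + 1)) g' ξ₃ (σ i) t₀)
          (Subtype.val ⁻¹' leftHandSphere (𝓡∂ (n + 1)) g' ξ₃ (σ i) t₀) k)
        (_ : ∃ φ : _ ≃ₗ[ℤ] ℤ, φ γ₀ = 1)
        (hAi : A ⊆ Ti.Pᶜ) (hAj : A ⊆ Tj.Pᶜ) (ui uj ti tj : ℤ)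
        (_ : ui = 1 ∨ ui = -1) (_ : uj = 1 ∨ uj = -1) (_ : ti = 1 ∨ ti = -1) (_ : tj = 1 ∨ tj = -1)
        (_ : Ti.functional hAi k (e i) = ui • Ti.baseClass g𝔼)
        (_ : Tj.functional hAj k (e j) = uj • Tj.baseClass g𝔼)
        (_ : Ti.functional hAi k ((relativeSingularHomology.map ℤ ℤ
              (⟨Set.inclusion h₁', continuous_inclusion h₁'⟩ :
                C(↥(leftHandDisc (𝓡∂ (n + 1)) g' ξ₃ (σ i) t₀), ↥X)) h₀' k).hom γ₀) = ti • Ti.baseClass g𝔼)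
        (_ : Tj.functional hAj k ((relativeSingularHomology.map ℤ ℤ
              (⟨Set.inclusion h₁', continuous_inclusion h₁'⟩ :
                C(↥(leftHandDisc (𝓡∂ (n + 1)) g' ξ₃ (σ i) t₀), ↥X)) h₀' k).hom γ₀) = tj • Tj.baseClass g𝔼),
        ui * ti = uj * tj) :
    Cobordism.Milnor1965_basisTheorem_slab.{u} := by
  refine Cobordism.Milnor1965_basisTheorem_slab_of_slideCrossing ?_
  intro n M N _ _ _ _ _ _ _ _ _ _ _ _ c g ξ t₀ t₁ b k a σ i j S ht₁ X hX A hXA e hdisc g𝔼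
  obtain ⟨ρ, hSgnρ⟩ := HSgn S ht₁ hX hXA e hdisc g𝔼
  refine ⟨ρ, ?_⟩
  intro f hfW hfFlat Φ hΦsm hΦsm' hsph hother O hOo hOsub hO hcentre r₀ hr₀ hr₀sub δ α hδ hαs hαδ hα2δ hαb F hcross hformula hearly hend ξ₃ hξ₃ hξ₃eq hpush hpull ν hνc hν0 hν1 hν01 t₁' t₂' h01' h12 h2c hνt htrack hleft hright hdisj g' hg' hξg' hcrit' hind hval hnear hIoo halt halt' hlocI hlocO
  obtain ⟨Ti, hDNi, hPi, hm0i, hdsti, hnhdi, hKmi, hgerm⟩ :=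
    S.exists_germDatum ht₁ hX hξ₃ hξ₃eq hg' hξg' hcrit' hind hval halt halt' g𝔼
  obtain ⟨Tj, hDNj, hPj, hm0j, hdstj, hnhdj, hKmj, hcrossv⟩ :=
    HV S ht₁ hX ρ f hfW hfFlat Φ hΦsm hΦsm' hsph hother O hOo hOsub hO hcentre r₀ hr₀ hr₀sub δ α hδ hαs hαδ hα2δ hαb F hcross hformula hearly hend ξ₃ hξ₃ hξ₃eq hpush hpull ν hνc hν0 hν1 hν01 t₁' t₂' h01' h12 h2c hνt htrack hleft hright hdisj g' hg' hξg' hcrit' hind hval hnear hIoo halt halt' hlocI hlocO g𝔼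
  refine ⟨Ti, Tj, hDNi, hDNj, hPi, hm0i, hdsti, hnhdi, hKmi, hPj, hm0j, hdstj, hnhdj, hKmj, ?_⟩
  intro h₁' h₀' γ₀ hγ₀ hAi hAj ui uj hui huj hei hej
  obtain ⟨ti, hti1, hxi⟩ : ∃ ti : ℤ, (ti = 1 ∨ ti = -1) ∧
      Ti.functional hAi k ((relativeSingularHomology.map ℤ ℤ
              (⟨Set.inclusion h₁', continuous_inclusion h₁'⟩ :
                C(↥(leftHandDisc (𝓡∂ (n + 1)) g' ξ₃ (σ i) t₀), ↥X)) h₀' k).hom γ₀) = ti • Ti.baseClass g𝔼 := by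
    rcases hgerm hAi h₁' h₀' γ₀ hγ₀ with h | h
    · exact ⟨1, Or.inl rfl, by rw [h, one_smul]⟩
    · exact ⟨-1, Or.inr rfl, by rw [h, neg_one_zsmul]⟩
  obtain ⟨tj, htj1, hxj⟩ : ∃ tj : ℤ, (tj = 1 ∨ tj = -1) ∧
      Tj.functional hAj k ((relativeSingularHomology.map ℤ ℤ
              (⟨Set.inclusion h₁', continuous_inclusion h₁'⟩ :
                C(↥(leftHandDisc (𝓡∂ (n + 1)) g' ξ₃ (σ i) t₀), ↥X)) h₀' k).hom γ₀) = tj • Tj.baseClass g𝔼 := by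
    rcases hcrossv hAj h₁' h₀' γ₀ hγ₀ with h | h
    · exact ⟨1, Or.inl rfl, by rw [h, one_smul]⟩
    · exact ⟨-1, Or.inr rfl, by rw [h, neg_one_zsmul]⟩
  have hsign : ui * ti = uj * tj :=
    hSgnρ f hfW hfFlat Φ hΦsm hΦsm' hsph hother O hOo hOsub hO hcentre r₀ hr₀ hr₀sub δ α hδ hαs hαδ hα2δ hαb F hcross hformula hearly hend ξ₃ hξ₃ hξ₃eq hpush hpull ν hνc hν0 hν1 hν01 t₁' t₂' h01' h12 h2c hνt htrack hleft hright hdisj g' hg' hξg' hcrit' hind hval hnear hIoo halt halt' hlocI hlocO Ti Tj hDNi hDNj hPi hm0i hdsti hnhdi hKmi hPj hm0j hdstj hnhdj hKmj h₁' h₀' γ₀ hγ₀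
      hAi hAj ui uj ti tj hui huj hti1 htj1 hei hej hxi hxj
  exact ⟨ti, tj, hti1, hxi, hxj, hsign⟩

end Literature.Topology.FourManifolds

end
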